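import Summits.BirchSwinnertonDyer.BirchSwinnertonDyer.Theorems.EisensteinPrimesMazurMCOnCellBTwistbackSubrowKernelDiscEven
import Summits.BirchSwinnertonDyer.Rank1Residual.Additive.X3BranchThreeLineCertificateCharactersTwoTimesPrimeThreeModFour
import HarnessLib

/-!
# Crux 3 `MazurMCOnCellB` (stmt-BirchSwinnertonDyer-19033), line `twistback` v5/v6 — the CHARACTER-FREE sub-row door for the
# last kernel-discriminant type `D = −2n*` (`√−2`-type: `χ₈χ₄ · (·/n)` modulo `8n`), part 5 of
# `…LocalBalanceAtUnramifiedPlace`: with parts 3–4, EVERY squarefree kernel discriminant (`n*`, `−n*`, `2n*`, `−2n*`) has one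

Width seat bsd-line-x2-p1-w7 (gen 2), cell `bsd-eis` (run/shared/lean/pub/bsd-eis/), 2026-08-28. HONEST FRAMING: §1 is
Gauss-sum / Dirichlet-character algebra over tree theorems (X3 cell's `Rat.exists_sqrt_neg_one_smul_eq_chi4`,
`Rat.exists_sqrt_two_smul_eq_chi8`, `isPrimitive_eight_three_of_apply_five`, `Rat.smul_mul_eq_changeLevel_mul`; w3 g8's
`exists_quadraticChar_radical`; the twist dictionary's `isPrimitive_changeLevel_mul_changeLevel`); §2 is a CONDITIONAL door
over part 3's `upperPartner_at_three_of_kernelRadical_of_padicGZ` with the named facts BY NAME as there (`PublishedInputs`;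
Disegni 2020 Thm. 4(1), Thm. 2.4; Greenberg–Vatsal Thm. (3.11); Nakagawa–Horie–Taya — all PUBLISHED). THEOREMS ONLY (no
`def`, no named fact introduced, no `sorry`); `--supports` stmt-BirchSwinnertonDyer-19033; closes no stub by itself; nothing
about any curve is proved unconditionally; no summit statement, no Mazur main conjecture and no BSD is proved for any curve;
0 cells / labels / tiers move.

WHY. A squarefree integer `D ≠ 0` is exactly one of `n*`, `−n*`, `2n*`, `−2n*` for `n = |D|` or `|D|/2` odd squarefree
(`n* = (−1)^{⌊n/2⌋}·n ≡ 1 (mod 4)`). Part 3 §4 (p663135) is the character-free door for `n*`, part 4 (p663697) for `−n*` and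
`2n*`; this file is `−2n*` (`ℚ(√D) ∋ √−2·√(n*)`; the A10 non-split cell `235200oj1` of the census `HOME/lam-a-g16/ca/cells.tsv`
has `D = 14 = −2·(−7)`).

* §1 `chi8_mul_chi4_apply_natCast` — the value table of the level-`8` character `χ₈·χ₄` (= Mathlib's `χ₈′` pointwise) on
  natural numbers; `exists_quadraticChar_geomSqrt_neg_two_mul_star` — `τ • √(−2n*) = χ(χ_{8n} τ)·√(−2n*)` for
  `χ = (χ₈χ₄)·(·/n)` modulo `8n`, `χ̄ = χ mod 3` PRIMITIVE (conductor `8` at `2` by the value `−1` at `5`), with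
  `χ(a) = χ₈(a)χ₄(a)·J(a | n)`.
* §2 `upperPartner_at_three_of_kernelDisc_neg_two_mul_of_padicGZ` — the door: identity with level `8n` and indicator
  `[χ₈(ℓ)χ₄(ℓ)·J(ℓ | n) = 1]`.

References: [Washington1997] Ch. 2–3; [IrelandRosen1990] Ch. 6 Prop. 6.3.2; [Cox2013] §1.C; [GreenbergVatsal2000] §2 Prop.
(2.4), p. 28, §3 Thm. (3.11), p. 43; [Disegni2020] §2.2 Thm. 2.4, §3.2 Thm. 4; [NakagawaHorie1988] Thm. 1.
-/

set_option autoImplicit false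
-- `Summit.BirchSwinnertonDyer.BirchSwinnertonDyer.…`: the summit and its single sub-problem share a name.
set_option linter.dupNamespace false

noncomputable section

open scoped Classical NumberTheorySymbols

open NumberField IsDedekindDomain Field WeierstrassCurve DirichletCharacter
  Literature.NumberTheory.EllipticCurves Literature.NumberTheory.GaloisRepresentations
  Literature.NumberTheory.EllipticCurves.GreenbergVatsal2000
  Literature.NumberTheory.EllipticCurves.Rank1Residual Literature.NumberTheory.EllipticCurves.Rank1Residual.Typed
  Literature.NumberTheory.EllipticCurves.Disegni2020 Literature.NumberTheory.EllipticCurves.KellerYin2024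
  Summit.BirchSwinnertonDyer.Rank1Residual Summit.BirchSwinnertonDyer.Rank1Residual.X2
  Summit.BirchSwinnertonDyer.Rank1Residual.Additive
  Summit.BirchSwinnertonDyer.BirchSwinnertonDyer.Theses
  Summit.BirchSwinnertonDyer.BirchSwinnertonDyer.Theorems.EisensteinPrimesMazurMCOnCellBTwistbackTwistLineCharacters
  Summit.BirchSwinnertonDyer.BirchSwinnertonDyer.Theorems.EisensteinPrimesMazurMCOnCellBTwistbackQuadraticRadical
  Summit.BirchSwinnertonDyer.BirchSwinnertonDyer.Theorems.EisensteinPrimesMazurMCOnCellBTwistbackSubrowLineCharBalance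
  Summit.BirchSwinnertonDyer.BirchSwinnertonDyer.Theorems.EisensteinPrimesMazurMCOnCellBTwistbackSubrowKernelDiscEven

namespace Summit.BirchSwinnertonDyer.BirchSwinnertonDyer.Theorems.EisensteinPrimesMazurMCOnCellBTwistbackSubrowKernelDiscNegTwo

/-! ## §1. Quadratic Kronecker–Weber, explicit, for `√(−2n*)`, `n` odd squarefree -/

/-- **Value table of the level-`8` character `χ₈·χ₄`** (the character of `ℚ(√−2)`; Mathlib's `χ₈′` pointwise): on a
natural number `a`, `(χ₈·χ₄)(a) = χ₈(a)·χ₄(a)` (both sides vanish at even `a`). [folklore] -/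
theorem chi8_mul_chi4_apply_natCast (a : ℕ) :
    (changeLevel (dvd_refl 8) ZMod.χ₈ * changeLevel (by norm_num : 4 ∣ 8) ZMod.χ₄ : MulChar (ZMod 8) ℤ) (a : ZMod 8) =
      ZMod.χ₈ (a : ZMod 8) * ZMod.χ₄ (a : ZMod 4) := by
  by_cases hc : a.Coprime 8
  · have hu8 : IsUnit (a : ZMod 8) := (ZMod.isUnit_iff_coprime a 8).mpr hc
    obtain ⟨u8, hu8'⟩ := hu8
    rw [← hu8', MulChar.mul_apply, DirichletCharacter.changeLevel_eq_cast_of_dvd _ (dvd_refl 8),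
      DirichletCharacter.changeLevel_eq_cast_of_dvd _ (by norm_num : 4 ∣ 8), hu8', ZMod.cast_natCast (dvd_refl 8),
      ZMod.cast_natCast (by norm_num : 4 ∣ 8)]
  · have hnu : ¬ IsUnit (a : ZMod 8) := fun h ↦ hc ((ZMod.isUnit_iff_coprime a 8).mp h)
    rw [MulChar.map_nonunit _ hnu]
    -- `a` is even, so `χ₈(a) = 0`
    have h2 : a % 2 = 0 := by
      by_contra hodd
      apply hc
      have hc2 : a.Coprime 2 := by
        rw [Nat.coprime_comm, Nat.Prime.coprime_iff_not_dvd Nat.prime_two]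
        omega
      rw [show (8 : ℕ) = 2 ^ 3 by norm_num]
      exact Nat.Coprime.pow_right 3 hc2
    rw [ZMod.χ₈_nat_eq_if_mod_eight, if_pos h2, zero_mul]

/-- **Quadratic Kronecker–Weber for `√(−2n*)`, `n` odd squarefree** (`n* = (−1)^{⌊n/2⌋}·n`; `−2n*` runs over the squarefree
`D` with `D/2 ≡ 3 (mod 4)`, field discriminant `4D`): a quadratic `ℤ`-valued character `χ` modulo `8n` —
`χ(a) = χ₈(a)χ₄(a)·J(a | n)` — with PRIMITIVE reduction modulo `3` and `τ • √(−2n*) = χ(χ_{8n}(τ)) • √(−2n*)`.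
`√(−2n*) = ±√2·√−1·√(n*)`: `χ₈` on `√2`, `χ₄` on `√−1` (X3 cell), the Jacobi radical of `√(n*)` (w3 g8); the level-`8`
factor `χ₈χ₄` read in `𝔽₃` is primitive because its value at `5 ≡ 1 (mod 4)` is `−1`
(`isPrimitive_eight_three_of_apply_five`). [cite: Washington1997, Ch. 2 and Ch. 3] [cite: IrelandRosen1990, Ch. 6 Prop. 6.3.2] -/
theorem exists_quadraticChar_geomSqrt_neg_two_mul_star {n : ℕ} [NeZero n] (hn : Odd n) (hsq : Squarefree n) :
    ∃ χ : MulChar (ZMod (8 * n)) ℤ, χ.IsQuadratic ∧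
      DirichletCharacter.IsPrimitive
        (χ.ringHomComp (Int.castRingHom (ZMod 3)) : DirichletCharacter (ZMod 3) (8 * n)) ∧
      (∀ a : ℕ, χ (a : ZMod (8 * n)) = ZMod.χ₈ (a : ZMod 8) * ZMod.χ₄ (a : ZMod 4) * J((a : ℤ) | n)) ∧
      ∀ τ : absoluteGaloisGroup ℚ,
        τ • geomSqrt ((-2 * ((-1 : ℤ) ^ (n / 2) * n) : ℤ) : ℚ) =
          ((χ (modNCyclotomicCharacter ℚ (8 * n) τ : ZMod (8 * n)) : ℤ) : AlgebraicClosure ℚ) *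
            geomSqrt ((-2 * ((-1 : ℤ) ^ (n / 2) * n) : ℤ) : ℚ) := by
  haveI : Fact (Nat.Prime 3) := ⟨Nat.prime_three⟩
  obtain ⟨χb, sb, hqb, hpb, hvb, -, hsb2, hτb⟩ :=
    EisensteinPrimesMazurMCOnCellBTwistbackQuadraticRadical.exists_quadraticChar_radical (p := 3) (by decide) n hn hsq
  obtain ⟨s₁, -, hs₁2, hτ₁⟩ := Rat.exists_sqrt_neg_one_smul_eq_chi4
  obtain ⟨s₂, -, hs₂2, hτ₂⟩ := Rat.exists_sqrt_two_smul_eq_chi8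
  -- the level-8 character of `√−2 = √2·√−1`
  set c₈ : MulChar (ZMod 8) ℤ := changeLevel (dvd_refl 8) ZMod.χ₈ * changeLevel (by norm_num : 4 ∣ 8) ZMod.χ₄ with hc₈
  have hτ₈ : ∀ τ : absoluteGaloisGroup ℚ,
      τ • (s₂ * s₁) = ((c₈ (modNCyclotomicCharacter ℚ 8 τ : ZMod 8) : ℤ) : AlgebraicClosure ℚ) * (s₂ * s₁) :=
    fun τ ↦ Rat.smul_mul_eq_changeLevel_mul (dvd_refl 8) (by norm_num : 4 ∣ 8) ZMod.χ₈ ZMod.χ₄ hτ₂ hτ₁ τ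
  have hq₈ : c₈.IsQuadratic := (ZMod.isQuadratic_χ₈.changeLevel_int _).mul_int (ZMod.isQuadratic_χ₄.changeLevel_int _)
  have hp₈ : DirichletCharacter.IsPrimitive (c₈.ringHomComp (Int.castRingHom (ZMod 3)) : DirichletCharacter (ZMod 3) 8) := by
    refine isPrimitive_eight_three_of_apply_five _ ?_
    rw [MulChar.ringHomComp_apply, hc₈, MulChar.mul_apply,
      DirichletCharacter.changeLevel_eq_cast_of_dvd' _ (dvd_refl 8) (by rw [Int.isCoprime_iff_gcd_eq_one]; decide),
      DirichletCharacter.changeLevel_eq_cast_of_dvd' _ (by norm_num : 4 ∣ 8)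
        (by rw [Int.isCoprime_iff_gcd_eq_one]; decide)]
    have h8 : ZMod.χ₈ ((5 : ℤ) : ZMod 8) = -1 := by decide
    have h4' : ZMod.χ₄ ((5 : ℤ) : ZMod 4) = 1 := by decide
    rw [h8, h4']
    simp
  have hcop : (8 : ℕ).Coprime n := by
    have h2 : Nat.Coprime 2 n :=
      (Nat.Prime.coprime_iff_not_dvd Nat.prime_two).mpr (Nat.two_dvd_ne_zero.mpr (Nat.odd_iff.mp hn))
    have : (8 : ℕ) = 2 ^ 3 := by norm_num
    rw [this]; exact Nat.Coprime.pow_left 3 h2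
  refine ⟨changeLevel (dvd_mul_right 8 n) c₈ * changeLevel (dvd_mul_left n 8) χb,
    (hq₈.changeLevel_int _).mul_int (hqb.changeLevel_int _), ?_, fun a ↦ ?_, fun τ ↦ ?_⟩
  · rw [MulChar.ringHomComp_mul, DirichletCharacter.ringHomComp_changeLevel,
      DirichletCharacter.ringHomComp_changeLevel]
    exact isPrimitive_changeLevel_mul_changeLevel hp₈ hpb hcop
  · rw [changeLevel_mul_changeLevel_apply_natCast, hvb, hc₈, chi8_mul_chi4_apply_natCast]
  · have hprod := Rat.smul_mul_eq_changeLevel_mul (dvd_mul_right 8 n) (dvd_mul_left n 8) c₈ χb hτ₈ hτb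
    refine EisensteinPrimesMazurMCOnCellBTwistbackSubrowKernelDiscEven.smul_geomSqrt_of_sq_eq ?_ hprod τ
    rw [mul_pow, mul_pow, hs₂2, hs₁2, hsb2, geomSqrt_sq, map_intCast]
    push_cast
    ring

/-! ## §2. The character-free door for `D = −2n*` -/

/-- **Stub 6 (∃-PARTNER) at a non-split X2b pair `(W, 3)`, character-free, kernel discriminant `D = −2n*`** (`n` odd
squarefree; field `ℚ(√D)` of discriminant `4D`; the A10 cell `235200oj1` with `d_unr = 14 = −2·(−7)`, `n = 7`). Part 3's
`upperPartner_at_three_of_kernelRadical_of_padicGZ` fed with §1's character: data = `Φ₀` (rational `3`-line), `n` with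
«`σ` fixes `Φ₀` pointwise iff `σ√(−2n*) = √(−2n*)`», `S₀ ⊇ A` with reduction types, and the decidable identity with level `8n`
and indicator `[χ₈(ℓ)χ₄(ℓ)·J(ℓ | n) = 1]`. PUBLISHED named facts only; conditional.
[cite: GreenbergVatsal2000, §2 Prop. (2.4), p. 28, §3 Thm. (3.11) and p. 43] [cite: Disegni2020, §2.2 Thm. 2.4 and §3.2 Thm. 4]
[cite: NakagawaHorie1988, Thm. 1] [cite: Washington1997, Ch. 2] -/
theorem upperPartner_at_three_of_kernelDisc_neg_two_mul_of_padicGZ (hP : EisensteinPrimes.PublishedInputs)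
    (hDis : padicBSD_rankOne_nonsplitMult) (h311 : thm311_hasUnitContent_iff_and_order_eq_of_lineRamifiedEven)
    (hDGZ : padicGrossZagier_nonsplitMult)
    (hNH : Literature.NumberTheory.QuadraticFields.nakagawaHorie_taya_exists_imaginary_h3_eq_one)
    (W : WeierstrassCurve ℚ) [W.IsElliptic] [W.IsGloballyMinimal]
    (hc : X2.CellB W 3) (hns : ¬ W.HasSplitMultiplicativeReductionAtPrime 3)
    {Φ₀ : AddSubgroup (geomTorsion W (3 : ℤ))} (hΦ : IsRationalLine W 3 Φ₀)
    {n : ℕ} [NeZero n] (hn : Odd n) (hsq : Squarefree n)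
    (hker : ∀ σ : absoluteGaloisGroup ℚ,
      (∀ Q ∈ Φ₀, σ • Q = Q) ↔ σ • geomSqrt ((-2 * ((-1 : ℤ) ^ (n / 2) * n) : ℤ) : ℚ) =
        geomSqrt ((-2 * ((-1 : ℤ) ^ (n / 2) * n) : ℤ) : ℚ))
    (S₀ : Finset (HeightOneSpectrum (𝓞 ℚ))) (hS₀p : ∀ v ∈ S₀, ((3 : ℕ) : 𝓞 ℚ) ∉ v.asIdeal)
    (hS : ∀ v : HeightOneSpectrum (𝓞 ℚ), v ∉ S₀ → ((3 : ℕ) : 𝓞 ℚ) ∉ v.asIdeal → W.HasGoodReductionAt v)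
    (A : Finset (HeightOneSpectrum (𝓞 ℚ))) (hAS : A ⊆ S₀) (hA : ∀ v ∈ A, W.HasAdditiveReductionAt v)
    (hmult : ∀ v ∈ S₀, v ∉ A → W.HasMultiplicativeReductionAt v)
    (hbal : 1 = ∑ v ∈ S₀ \ A, (if W.HasSplitMultiplicativeReductionAt v
          then sFactor 3 (Rat.HeightOneSpectrum.natGenerator v) else 0) +
      ∑ v ∈ A, (if Rat.HeightOneSpectrum.natGenerator v ∣ 8 * n then 0 else
        if Rat.HeightOneSpectrum.natGenerator v % 3 = 2 then sFactor 3 (Rat.HeightOneSpectrum.natGenerator v)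
        else 2 * (if ZMod.χ₈ (Rat.HeightOneSpectrum.natGenerator v : ZMod 8) *
            ZMod.χ₄ (Rat.HeightOneSpectrum.natGenerator v : ZMod 4) *
            J((Rat.HeightOneSpectrum.natGenerator v : ℤ) | n) = 1
          then sFactor 3 (Rat.HeightOneSpectrum.natGenerator v) else 0))) :
    ∃ (K : Type) (_ : Field K) (_ : NumberField K), IsImaginaryQuadratic K ∧
      SatisfiesHeegnerHypothesis (W.conductorNorm ℤ) K ∧ SatisfiesHeegnerHypothesis 3 K ∧
      Odd (NumberField.discr K) ∧ NumberField.discr K < -4 ∧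
      (W.quadraticTwist (NumberField.discr K : ℚ)).analyticRank = 1 ∧
      ∀ (Wd : WeierstrassCurve ℚ) [Wd.IsElliptic] [Wd.IsGloballyMinimal],
        (∃ C : VariableChange ℚ, C • Wd = W.quadraticTwist (NumberField.discr K : ℚ)) →
        MissingUpperBoundAt Wd 3 := by
  haveI : NeZero (8 * n) := ⟨mul_ne_zero (by norm_num) (NeZero.ne _)⟩
  obtain ⟨χ, hχ2, hprim, hval, hrad⟩ := exists_quadraticChar_geomSqrt_neg_two_mul_star hn hsq
  have hD0 : ((-2 * ((-1 : ℤ) ^ (n / 2) * n) : ℤ) : ℚ) ≠ 0 := by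
    have hn0 : (n : ℤ) ≠ 0 := by exact_mod_cast NeZero.ne n
    have : (-2 * ((-1 : ℤ) ^ (n / 2) * n) : ℤ) ≠ 0 :=
      mul_ne_zero (by norm_num) (mul_ne_zero (pow_ne_zero _ (by norm_num)) hn0)
    exact_mod_cast this
  refine EisensteinPrimesMazurMCOnCellBTwistbackSubrowLineCharBalance.upperPartner_at_three_of_kernelRadical_of_padicGZ
    hP hDis h311 hDGZ hNH W hc hns hΦ χ hχ2 hprim (geomSqrt_ne_zero hD0) hrad hker S₀ hS₀p hS A hAS hA hmult ?_
  rw [hbal]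
  congr 1
  refine Finset.sum_congr rfl fun v _ ↦ ?_
  rw [hval]

end Summit.BirchSwinnertonDyer.BirchSwinnertonDyer.Theorems.EisensteinPrimesMazurMCOnCellBTwistbackSubrowKernelDiscNegTwo

end
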